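import Summits.Parity.GeneralizedHardyLittlewood.Theorems.FordMaynardSieveConst01651SieveConst01651LinePart05
import HarnessLib

/-!
# Route `FordMaynardSieveConst01651`, target `SieveConst01651` (stmt-Parity-19185): line `sieve_decomposition` re-homed — proofs, part 6 of 11 (file 7 of 12)

File 7 of 12 of the VERBATIM re-homing under `Theorems/` of the registered line skeleton
`Summits/Parity/GeneralizedHardyLittlewood/Cruxes/SieveConst01651/Lines/sieve_decomposition.lean` (v21, sha16
`ada6d0765119a11e`; author seat `linewriter-parity-smallroutes-1`, g0 v1–v20 / g1 v21): Ford–Maynard, Theorem 7.3 (a) at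
`P = (1/2, 0, ν)` with CLOSED support, cut along arXiv:2407.14368 §7.2 / §6.2, composed down to the route target
`Summit.Parity.GeneralizedHardyLittlewood.Theses.FordMaynardSieveConst01651.SieveConst01651`.  Namespace
`Summit.Parity.GeneralizedHardyLittlewood.FordMaynardSieveConst01651SieveDecomposition` (fresh; the `Cruxes` copy keeps its own), files of
≤ 400 lines chained by import; the three registered stubs are replaced by their landed proofs
(`…StubSignClauseFive` p834287, `…StubCertValuePos` p837763, `…TypeIIRegion` p833045), so the skeleton's composition
`SieveConst01651_of_stubs` (last part) is sorry-free.  Mathematics, statements and comments are the linewriter's; this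
re-homing (hand `leafhand-parity-fordmaynardsieveco-2` g4) only moved the definitions (`Eset`, `sliceTest`, `mainG1`, `vk`,
the `Signature.*` statement abbreviations, `Phi`, `innerI`, `jumpSet`, `gval`, `symmExt`, `idxProd`, `gam`) into the first
file, added docstrings where missing, and renamed two unused binders.
Declarations in this part: `gam_eq_zero`, `coe_ofFn_orderEmb`, `starSum_eq_sum_gam`, `sum_finset_fin_succ`, `map_val_map_castSucc`, `map_val_insert_last`, `sum_gam_snoc`, `starSum_snoc_of_half_lt`, `exists_perm_eq_comp`, `sum_gam_comp_perm`, `sum_gam_eq_of_coe_eq`, `forall_snoc_lt`, `dvd_mul_of_not_sq_dvd`, `sum_divisors_eq_sum_divisors_mul`, `coe_ofFn_pvec_mul`, `structure_of_not_squarefree`, `sign_p3`.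

References: [FordMaynard2024PrimeSieves] K. Ford, J. Maynard, *On the theory of prime producing sieves*, arXiv:2407.14368,
Theorem 7.3 (a), Proposition 7.19, §6.2, §7.2, §8.2.
-/

noncomputable section

open Finset
open Literature.NumberTheory.Sieve Literature.NumberTheory.Sieve.FordMaynard Literature.Barriers.Parity.FordMaynard
open Summit.Parity.GeneralizedHardyLittlewood.FordMaynardSieveConst01651SieveConst01651
  (hfun Admissible hfun_apply hfun_of_ne pvec roughPart smoothPart Gwt Hwt window IsRough Nset Rset mem_window mem_Nset mem_Rset
   coneCert openSmall stub_hkPieces stub_coneCertClosed_of_residues' coneCert_signClause_five_of_generic)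

namespace Summit.Parity.GeneralizedHardyLittlewood.FordMaynardSieveConst01651SieveDecomposition

/-- `gam_eq_zero` — lemma of the line skeleton `sieve_decomposition` (v21, seat `linewriter-parity-smallroutes-1`), re-homed verbatim. [folklore] -/
theorem gam_eq_zero {ν : ℝ} {g : VecFn} (hadm : Admissible ν g) {s : Multiset ℝ} (hs0 : s ≠ 0)
    (hsum : 1 / 2 < s.sum) : gam g s = 0 := by
  obtain ⟨-, -, -, hsupp, -⟩ := hadm
  by_contra hne
  rcases hsupp _ _ hne with h0 | ⟨-, hle⟩
  · apply hs0
    have : s.toList = [] := List.eq_nil_of_length_eq_zero h0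
    rw [← Multiset.coe_toList s, this]
    rfl
  · have hsum' : ∑ i, s.toList.get i = s.sum := by
      simp only [List.get_eq_getElem, Fin.sum_univ_getElem, Multiset.sum_toList]
    linarith

/-- `coe_ofFn_orderEmb` — lemma of the line skeleton `sieve_decomposition` (v21, seat `linewriter-parity-smallroutes-1`), re-homed verbatim. [folklore] -/
theorem coe_ofFn_orderEmb {K : ℕ} (x : Fin K → ℝ) (B : Finset (Fin K)) :
    (↑(List.ofFn fun i => x (B.orderEmbOfFin rfl i)) : Multiset ℝ) = B.val.map x := by
  have h1 : (List.ofFn fun i => x (B.orderEmbOfFin rfl i)) = (List.ofFn (B.orderEmbOfFin rfl)).map x := by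
    rw [List.map_ofFn]
    rfl
  rw [h1, ← Multiset.map_coe]
  congr 1
  have h2 := congrArg Finset.val (Finset.map_orderEmbOfFin_univ B rfl)
  rw [Finset.map_val, Finset.val_univ_fin] at h2
  rw [← h2, Multiset.map_coe, ← List.ofFn_eq_map]
  rfl

/-- `starSum_eq_sum_gam` — lemma of the line skeleton `sieve_decomposition` (v21, seat `linewriter-parity-smallroutes-1`), re-homed verbatim. [folklore] -/
theorem starSum_eq_sum_gam {g : VecFn} (hs : g.IsSymmetric) (K : ℕ) (x : Fin K → ℝ) :
    starSum g K x = ∑ B : Finset (Fin K), gam g (B.val.map x) := by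
  unfold starSum
  refine Finset.sum_congr rfl fun B _ => ?_
  rw [← coe_ofFn_orderEmb, gam_coe_ofFn hs]

/-- `sum_finset_fin_succ` — lemma of the line skeleton `sieve_decomposition` (v21, seat `linewriter-parity-smallroutes-1`), re-homed verbatim. [folklore] -/
theorem sum_finset_fin_succ (K : ℕ) (F : Finset (Fin (K + 1)) → ℝ) :
    ∑ B : Finset (Fin (K + 1)), F B
      = ∑ B' : Finset (Fin K), F (B'.map Fin.castSuccEmb)
        + ∑ B' : Finset (Fin K), F (insert (Fin.last K) (B'.map Fin.castSuccEmb)) := by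
  classical
  have huniv : (Finset.univ : Finset (Fin (K + 1)))
      = insert (Fin.last K) ((Finset.univ : Finset (Fin K)).image Fin.castSucc) := by
    ext i
    refine ⟨fun _ => ?_, fun _ => Finset.mem_univ _⟩
    rcases Fin.eq_castSucc_or_eq_last i with ⟨j, rfl⟩ | rfl
    · exact Finset.mem_insert_of_mem (Finset.mem_image_of_mem _ (Finset.mem_univ _))
    · exact Finset.mem_insert_self _ _
  have hnot : Fin.last K ∉ (Finset.univ : Finset (Fin K)).image Fin.castSucc := by
    intro h
    obtain ⟨a, -, ha⟩ := Finset.mem_image.1 h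
    exact (Fin.castSucc_lt_last a).ne ha
  have hinj : Function.Injective (fun B' : Finset (Fin K) => B'.image Fin.castSucc) :=
    Finset.image_injective (Fin.castSucc_injective K)
  have hmap : ∀ B' : Finset (Fin K), B'.map Fin.castSuccEmb = B'.image Fin.castSucc := fun B' =>
    Finset.map_eq_image _ _
  simp only [hmap]
  calc ∑ B : Finset (Fin (K + 1)), F B
      = ∑ B ∈ (Finset.univ : Finset (Fin (K + 1))).powerset, F B := by rw [Finset.powerset_univ]
    _ = ∑ B ∈ ((Finset.univ : Finset (Fin K)).image Fin.castSucc).powerset, F B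
          + ∑ B ∈ ((Finset.univ : Finset (Fin K)).image Fin.castSucc).powerset, F (insert (Fin.last K) B) := by
        rw [huniv, Finset.sum_powerset_insert hnot]
    _ = _ := by
        rw [Finset.powerset_image, Finset.sum_image fun a _ b _ h => hinj h,
          Finset.sum_image fun a _ b _ h => hinj h, Finset.powerset_univ]

/-- `map_val_map_castSucc` — lemma of the line skeleton `sieve_decomposition` (v21, seat `linewriter-parity-smallroutes-1`), re-homed verbatim. [folklore] -/
theorem map_val_map_castSucc {K : ℕ} (B' : Finset (Fin K)) (x : Fin (K + 1) → ℝ) :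
    (B'.map Fin.castSuccEmb).val.map x = B'.val.map (fun j => x (Fin.castSucc j)) := by
  rw [Finset.map_val, Multiset.map_map]
  rfl

/-- `map_val_insert_last` — lemma of the line skeleton `sieve_decomposition` (v21, seat `linewriter-parity-smallroutes-1`), re-homed verbatim. [folklore] -/
theorem map_val_insert_last {K : ℕ} (B' : Finset (Fin K)) (x : Fin (K + 1) → ℝ) :
    (insert (Fin.last K) (B'.map Fin.castSuccEmb)).val.map x
      = x (Fin.last K) ::ₘ B'.val.map (fun j => x (Fin.castSucc j)) := by
  classical
  have hnot : Fin.last K ∉ B'.map Fin.castSuccEmb := by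
    intro h
    obtain ⟨a, -, ha⟩ := Finset.mem_map.1 h
    exact (Fin.castSucc_lt_last a).ne ha
  rw [Finset.insert_val_of_notMem hnot, Multiset.map_cons, map_val_map_castSucc]

/-- `sum_gam_snoc` — lemma of the line skeleton `sieve_decomposition` (v21, seat `linewriter-parity-smallroutes-1`), re-homed verbatim. [folklore] -/
theorem sum_gam_snoc (g : VecFn) {K : ℕ} (v : Fin K → ℝ) (t : ℝ) (Φ : Multiset ℝ → Multiset ℝ) :
    ∑ B : Finset (Fin (K + 1)), gam g (Φ (B.val.map (Fin.snoc v t : Fin (K + 1) → ℝ)))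
      = ∑ B' : Finset (Fin K), gam g (Φ (B'.val.map v))
        + ∑ B' : Finset (Fin K), gam g (Φ (t ::ₘ B'.val.map v)) := by
  rw [sum_finset_fin_succ]
  simp only [map_val_map_castSucc, map_val_insert_last, Fin.snoc_castSucc, Fin.snoc_last]

/-- `starSum_snoc_of_half_lt` — lemma of the line skeleton `sieve_decomposition` (v21, seat `linewriter-parity-smallroutes-1`), re-homed verbatim. [folklore] -/
theorem starSum_snoc_of_half_lt {ν : ℝ} {g : VecFn} (hadm : Admissible ν g) {K : ℕ} (v : Fin K → ℝ)
    (hv : ∀ i, 0 ≤ v i) {t : ℝ} (ht : 1 / 2 < t) :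
    starSum g (K + 1) (Fin.snoc v t) = starSum g K v := by
  have hs : g.IsSymmetric := hadm.1
  have hsplit := sum_gam_snoc g v t id
  simp only [id] at hsplit
  rw [starSum_eq_sum_gam hs, starSum_eq_sum_gam hs, hsplit]
  have hzero : ∀ B' : Finset (Fin K), gam g (t ::ₘ B'.val.map v) = 0 := by
    intro B'
    apply gam_eq_zero hadm (Multiset.cons_ne_zero)
    rw [Multiset.sum_cons]
    have : 0 ≤ (B'.val.map v).sum :=
      Multiset.sum_nonneg fun y hy => by
        obtain ⟨i, -, rfl⟩ := Multiset.mem_map.1 hy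
        exact hv i
    linarith
  simp [hzero]

/-- `exists_perm_eq_comp` — lemma of the line skeleton `sieve_decomposition` (v21, seat `linewriter-parity-smallroutes-1`), re-homed verbatim. [folklore] -/
theorem exists_perm_eq_comp {K : ℕ} {f f' : Fin K → ℝ} (h : (List.ofFn f).Perm (List.ofFn f')) :
    ∃ σ : Equiv.Perm (Fin K), f' = f ∘ σ := by
  have heq : List.ofFn (f ∘ Tuple.sort f) = List.ofFn (f' ∘ Tuple.sort f') := by
    apply List.Perm.eq_of_sortedLE (Tuple.monotone_sort f).sortedLE_ofFn (Tuple.monotone_sort f').sortedLE_ofFn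
    exact ((Equiv.Perm.ofFn_comp_perm _ _).trans h).trans (Equiv.Perm.ofFn_comp_perm _ _).symm
  have hfun : f ∘ Tuple.sort f = f' ∘ Tuple.sort f' := List.ofFn_injective heq
  refine ⟨(Tuple.sort f').symm.trans (Tuple.sort f), ?_⟩
  funext x
  have := congrFun hfun ((Tuple.sort f').symm x)
  simp only [Function.comp_apply, Equiv.apply_symm_apply] at this
  simp only [Function.comp_apply, Equiv.trans_apply]
  exact this.symm

/-- `sum_gam_comp_perm` — lemma of the line skeleton `sieve_decomposition` (v21, seat `linewriter-parity-smallroutes-1`), re-homed verbatim. [folklore] -/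
theorem sum_gam_comp_perm (g : VecFn) {K : ℕ} (x : Fin K → ℝ) (σ : Equiv.Perm (Fin K))
    (Φ : Multiset ℝ → Multiset ℝ) :
    ∑ B : Finset (Fin K), gam g (Φ (B.val.map (x ∘ σ))) = ∑ B : Finset (Fin K), gam g (Φ (B.val.map x)) := by
  have h : ∀ B : Finset (Fin K), B.val.map (x ∘ σ) = (B.map σ.toEmbedding).val.map x := by
    intro B
    rw [Finset.map_val, Multiset.map_map]
    rfl
  simp_rw [h]
  exact Equiv.sum_comp (Equiv.finsetCongr σ) (fun B : Finset (Fin K) => gam g (Φ (B.val.map x)))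

/-- `sum_gam_eq_of_coe_eq` — lemma of the line skeleton `sieve_decomposition` (v21, seat `linewriter-parity-smallroutes-1`), re-homed verbatim. [folklore] -/
theorem sum_gam_eq_of_coe_eq (g : VecFn) {K K' : ℕ} {f : Fin K → ℝ} {f' : Fin K' → ℝ}
    (h : (↑(List.ofFn f) : Multiset ℝ) = ↑(List.ofFn f')) (Φ : Multiset ℝ → Multiset ℝ) :
    ∑ B : Finset (Fin K), gam g (Φ (B.val.map f)) = ∑ B : Finset (Fin K'), gam g (Φ (B.val.map f')) := by
  have hK : K = K' := by simpa using congrArg Multiset.card h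
  subst hK
  obtain ⟨σ, rfl⟩ := exists_perm_eq_comp (Multiset.coe_eq_coe.1 h)
  exact (sum_gam_comp_perm g f σ Φ).symm

/-- `forall_snoc_lt` — lemma of the line skeleton `sieve_decomposition` (v21, seat `linewriter-parity-smallroutes-1`), re-homed verbatim. [folklore] -/
theorem forall_snoc_lt {K : ℕ} {v : Fin K → ℝ} {t ν : ℝ} (hv : ∀ i, ν < v i) (ht : ν < t) :
    ∀ i, ν < (Fin.snoc v t : Fin (K + 1) → ℝ) i := by
  intro i
  rcases Fin.eq_castSucc_or_eq_last i with ⟨j, rfl⟩ | rfl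
  · simpa using hv j
  · simpa using ht

/-- `dvd_mul_of_not_sq_dvd` — lemma of the line skeleton `sieve_decomposition` (v21, seat `linewriter-parity-smallroutes-1`), re-homed verbatim. [folklore] -/
theorem dvd_mul_of_not_sq_dvd {p a m d : ℕ} (hp : p.Prime) (hpm : ¬ p ∣ m) (hm : m ≠ 0) (hd : d ∣ p ^ a * m)
    (h2 : ¬ p ^ 2 ∣ d) : d ∣ p * m := by
  have hpa : p ^ a * m ≠ 0 := mul_ne_zero (pow_ne_zero _ hp.ne_zero) hm
  have hd0 : d ≠ 0 := ne_zero_of_dvd_ne_zero hpa hd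
  rw [← Nat.factorization_le_iff_dvd hd0 (mul_ne_zero hp.ne_zero hm)]
  have hle := (Nat.factorization_le_iff_dvd hd0 hpa).2 hd
  intro q
  have hq := hle q
  rw [Nat.factorization_mul (pow_ne_zero _ hp.ne_zero) hm, Finsupp.add_apply, Nat.factorization_pow,
    Finsupp.smul_apply, smul_eq_mul] at hq
  rw [Nat.factorization_mul hp.ne_zero hm, Finsupp.add_apply]
  by_cases hqp : q = p
  · subst hqp
    rw [hp.factorization_self]
    have h1 : d.factorization q < 2 := by
      by_contra hge
      exact h2 ((hp.pow_dvd_iff_le_factorization hd0).2 (not_lt.1 hge))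
    omega
  · have h0 : p.factorization q = 0 := by
      rw [hp.factorization, Finsupp.single_apply, if_neg (Ne.symm hqp)]
    rw [h0] at hq ⊢
    simpa using hq

/-- `sum_divisors_eq_sum_divisors_mul` — lemma of the line skeleton `sieve_decomposition` (v21, seat `linewriter-parity-smallroutes-1`), re-homed verbatim. [folklore] -/
theorem sum_divisors_eq_sum_divisors_mul {ν : ℝ} {g : VecFn} (hadm : Admissible ν g) {n p a m : ℕ} (hn : 2 ≤ n)
    (hp : p.Prime) (hpm : ¬ p ∣ m) (hm : m ≠ 0) (ha : 1 ≤ a) (hnpam : n = p ^ a * m)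
    (hp4 : (n : ℝ) ^ (1 / 4 : ℝ) < p) :
    ∑ d ∈ n.divisors, g d.primeFactorsList.length (pvec n d)
      = ∑ d ∈ (p * m).divisors, g d.primeFactorsList.length (pvec n d) := by
  have hn0 : n ≠ 0 := by omega
  symm
  apply Finset.sum_subset
  · apply Nat.divisors_subset_of_dvd hn0
    rw [hnpam]
    exact mul_dvd_mul_right (dvd_pow_self p (by omega)) m
  · intro d hd hd'
    have hdn : d ∣ n := Nat.dvd_of_mem_divisors hd
    have hd0 : d ≠ 0 := ne_zero_of_dvd_ne_zero hn0 hdn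
    have hndvd : ¬ d ∣ p * m := fun h => hd' (Nat.mem_divisors.2 ⟨h, mul_ne_zero hp.ne_zero hm⟩)
    have hp2 : p ^ 2 ∣ d := by
      by_contra h2
      exact hndvd (dvd_mul_of_not_sq_dvd hp hpm hm (hnpam ▸ hdn) h2)
    apply apply_pvec_eq_zero_of_sqrt_lt hadm hn hd0
    have hnpos : (0 : ℝ) ≤ n := by positivity
    have hp2le : ((p : ℝ)) ^ 2 ≤ d := by exact_mod_cast Nat.le_of_dvd (Nat.pos_of_ne_zero hd0) hp2
    have h14 : 0 ≤ (n : ℝ) ^ (1 / 4 : ℝ) := Real.rpow_nonneg hnpos _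
    calc (n : ℝ) ^ (1 / 2 : ℝ) = ((n : ℝ) ^ (1 / 4 : ℝ)) ^ 2 := by
            rw [← Real.rpow_mul_natCast hnpos]; norm_num
      _ < (p : ℝ) ^ 2 := pow_lt_pow_left₀ hp4 h14 (by norm_num)
      _ ≤ d := hp2le

/-- `coe_ofFn_pvec_mul` — lemma of the line skeleton `sieve_decomposition` (v21, seat `linewriter-parity-smallroutes-1`), re-homed verbatim. [folklore] -/
theorem coe_ofFn_pvec_mul (n : ℕ) {p m : ℕ} (hp : p.Prime) (hm : m ≠ 0) :
    (↑(List.ofFn (pvec n (p * m))) : Multiset ℝ)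
      = ↑(List.ofFn (Fin.snoc (pvec n m) (Real.log p / Real.log n) :
          Fin (m.primeFactorsList.length + 1) → ℝ)) := by
  rw [Multiset.coe_eq_coe]
  have h2 : List.ofFn (Fin.snoc (pvec n m) (Real.log p / Real.log n) : Fin (m.primeFactorsList.length + 1) → ℝ)
      = (m.primeFactorsList ++ [p]).map (fun q : ℕ => Real.log q / Real.log n) := by
    rw [List.ofFn_succ', List.concat_eq_append, List.map_append, List.map_singleton, ← ofFn_pvec]
    congr 1
    · congr 1
      funext i
      simp [Fin.snoc_castSucc]
    · simp [Fin.snoc_last]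
  rw [h2, ofFn_pvec]
  apply List.Perm.map
  refine (Nat.perm_primeFactorsList_mul hp.ne_zero hm).trans ?_
  rw [Nat.primeFactorsList_prime hp]
  exact List.perm_append_comm

/-- `structure_of_not_squarefree` — lemma of the line skeleton `sieve_decomposition` (v21, seat `linewriter-parity-smallroutes-1`), re-homed verbatim. [folklore] -/
theorem structure_of_not_squarefree {n : ℕ} (hn : 2 ≤ n) (hexc : ¬ IsExc n) (hsq : ¬ Squarefree n) :
    ∃ p m a : ℕ, p.Prime ∧ ¬ p ∣ m ∧ Squarefree m ∧ m ≠ 0 ∧ (a = 2 ∧ 1 < m ∨ a = 3) ∧ n = p ^ a * m ∧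
      (n : ℝ) ^ (1 / 4 : ℝ) < p := by
  have hn0 : n ≠ 0 := by omega
  rw [Nat.squarefree_iff_prime_squarefree] at hsq
  push Not at hsq
  obtain ⟨p, hp, hpp⟩ := hsq
  have hp2 : p ^ 2 ∣ n := by rwa [pow_two]
  have hpn : p ∣ n := (dvd_mul_right p p).trans hpp
  have hpf : p ∈ n.primeFactors := Nat.mem_primeFactors.2 ⟨hp, hpn, hn0⟩
  unfold IsExc at hexc
  push Not at hexc
  obtain ⟨h1, h2⟩ := hexc
  have hp4 : (n : ℝ) ^ (1 / 4 : ℝ) < p := h1 p hpf hp2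
  have hdecomp : p ^ n.factorization p * (n / p ^ n.factorization p) = n := Nat.ordProj_mul_ordCompl_eq_self n p
  have hpm : ¬ p ∣ n / p ^ n.factorization p := Nat.not_dvd_ordCompl hp hn0
  have hm0 : n / p ^ n.factorization p ≠ 0 := (Nat.ordCompl_pos p hn0).ne'
  have ha2 : 2 ≤ n.factorization p := (hp.pow_dvd_iff_le_factorization hn0).1 hp2
  have hnpos : (0 : ℝ) ≤ n := by positivity
  have h14 : 0 ≤ (n : ℝ) ^ (1 / 4 : ℝ) := Real.rpow_nonneg hnpos _
  have hn4 : ((n : ℝ) ^ (1 / 4 : ℝ)) ^ 4 = n := by rw [← Real.rpow_mul_natCast hnpos]; norm_num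
  have ha3 : n.factorization p ≤ 3 := by
    by_contra h4
    have h4' : p ^ 4 ∣ n := (hp.pow_dvd_iff_le_factorization hn0).2 (by omega)
    have h4'' : ((p : ℝ)) ^ 4 ≤ n := by exact_mod_cast Nat.le_of_dvd (by omega) h4'
    have : ((n : ℝ) ^ (1 / 4 : ℝ)) ^ 4 < (p : ℝ) ^ 4 := pow_lt_pow_left₀ hp4 h14 (by norm_num)
    linarith
  have hmdvd : n / p ^ n.factorization p ∣ n := Dvd.intro_left _ hdecomp
  have hmsq : Squarefree (n / p ^ n.factorization p) := by
    rw [Nat.squarefree_iff_prime_squarefree]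
    intro q hq hqq
    have hqm : q ∣ n / p ^ n.factorization p := (dvd_mul_right q q).trans hqq
    have hq2n : q ^ 2 ∣ n := by rw [pow_two]; exact hqq.trans hmdvd
    have hqf : q ∈ n.primeFactors := Nat.mem_primeFactors.2 ⟨hq, hqm.trans hmdvd, hn0⟩
    have hq4 : (n : ℝ) ^ (1 / 4 : ℝ) < q := h1 q hqf hq2n
    have hdiv : p ^ 2 * (q * q) ∣ n := by
      rw [← hdecomp]
      exact mul_dvd_mul (pow_dvd_pow p ha2) hqq
    have hle : ((p : ℝ)) ^ 2 * ((q : ℝ) * q) ≤ n := by exact_mod_cast Nat.le_of_dvd (by omega) hdiv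
    have hpp2 : ((n : ℝ) ^ (1 / 4 : ℝ)) ^ 2 < (p : ℝ) ^ 2 := pow_lt_pow_left₀ hp4 h14 (by norm_num)
    have hqq2 : ((n : ℝ) ^ (1 / 4 : ℝ)) ^ 2 < (q : ℝ) * q := by
      rw [← pow_two]; exact pow_lt_pow_left₀ hq4 h14 (by norm_num)
    have hprod : ((n : ℝ) ^ (1 / 4 : ℝ)) ^ 2 * ((n : ℝ) ^ (1 / 4 : ℝ)) ^ 2 < (p : ℝ) ^ 2 * ((q : ℝ) * q) :=
      mul_lt_mul'' hpp2 hqq2 (by positivity) (by positivity)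
    have h44 : ((n : ℝ) ^ (1 / 4 : ℝ)) ^ 2 * ((n : ℝ) ^ (1 / 4 : ℝ)) ^ 2 = n := by rw [← pow_add]; exact hn4
    linarith
  refine ⟨p, n / p ^ n.factorization p, n.factorization p, hp, hpm, hmsq, hm0, ?_, hdecomp.symm, hp4⟩
  rcases (by omega : n.factorization p = 2 ∨ n.factorization p = 3) with h | h
  · left
    refine ⟨h, ?_⟩
    by_contra hm1
    apply h2 p hpf
    have hm1' : n / p ^ n.factorization p = 1 := by
      rcases Nat.lt_or_ge 1 (n / p ^ n.factorization p) with h' | h'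
      · exact absurd h' hm1
      · exact le_antisymm h' (Nat.pos_of_ne_zero hm0)
    rw [← hdecomp, hm1', h, mul_one]
  · right
    exact h

/-- `sign_p3` — lemma of the line skeleton `sieve_decomposition` (v21, seat `linewriter-parity-smallroutes-1`), re-homed verbatim. [folklore] -/
theorem sign_p3 {ν : ℝ} (hν : 0 < ν) (hν4 : ν < 1 / 4) {g : VecFn} (hadm : Admissible ν g) {n p m : ℕ}
    (hn : 2 ≤ n) (hr : IsRough ν n) (hp : p.Prime) (hpm : ¬ p ∣ m) (hm : m ≠ 0) (hmsq : Squarefree m)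
    (hnpm : n = p ^ 3 * m) (hp4 : (n : ℝ) ^ (1 / 4 : ℝ) < p) :
    ∑ d ∈ n.divisors, g d.primeFactorsList.length (pvec n d) ≤ 0 := by
  have hpm0 : p * m ≠ 0 := mul_ne_zero hp.ne_zero hm
  have hpmsq : Squarefree (p * m) := by
    rw [Nat.squarefree_mul ((Nat.Prime.coprime_iff_not_dvd hp).2 hpm)]
    exact ⟨Irreducible.squarefree hp, hmsq⟩
  rw [sum_divisors_eq_sum_divisors_mul hadm hn hp hpm hm (by norm_num) hnpm hp4,
    sum_divisors_eq_starSum n hpm0 hpmsq]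
  have hnpos : (0 : ℝ) < n := by exact_mod_cast (by omega : 0 < n)
  have hlogn : 0 < Real.log n := Real.log_pos (by exact_mod_cast (by omega : 1 < n))
  have hlogp : Real.log n < 4 * Real.log p := by
    have h := Real.log_lt_log (Real.rpow_pos_of_pos hnpos _) hp4
    rw [Real.log_rpow hnpos] at h
    linarith
  have hxp : 1 / 4 < Real.log p / Real.log n := by rw [lt_div_iff₀ hlogn]; linarith
  have hdvd : p * m ∣ n := by rw [hnpm]; exact mul_dvd_mul_right (dvd_pow_self p (by norm_num)) m
  have hwpos : ∀ i, 0 ≤ pvec n (p * m) i := fun i => pvec_nonneg hn _ i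
  have hwlow : ∀ i, ν < pvec n (p * m) i := fun i => nu_lt_pvec hn hr hdvd i
  have hsumw : ∑ i, pvec n (p * m) i = Real.log (p * m : ℕ) / Real.log n := _root_.Summit.Parity.GeneralizedHardyLittlewood.FordMaynardSieveConst01651SieveConst01651.sum_pvec' hpm0
  have hlogpm : Real.log (p * m : ℕ) = Real.log p + Real.log m := by
    push_cast
    exact Real.log_mul (by exact_mod_cast hp.ne_zero) (by exact_mod_cast hm)
  have hlognn : Real.log n = 3 * Real.log p + Real.log m := by
    rw [hnpm]
    push_cast
    rw [Real.log_mul (pow_ne_zero _ (by exact_mod_cast hp.ne_zero)) (by exact_mod_cast hm), Real.log_pow]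
    push_cast
    ring
  have hK1 : 1 ≤ (p * m).primeFactorsList.length :=
    List.length_pos_of_mem ((Nat.mem_primeFactorsList hpm0).2 ⟨hp, dvd_mul_right p m⟩)
  have hsum1 : ∑ i, (Fin.snoc (pvec n (p * m)) (2 * (Real.log p / Real.log n)) :
      Fin ((p * m).primeFactorsList.length + 1) → ℝ) i = 1 := by
    rw [Fin.sum_snoc, hsumw, hlogpm]
    have : (Real.log p + Real.log m) / Real.log n + 2 * (Real.log p / Real.log n)
        = (3 * Real.log p + Real.log m) / Real.log n := by ring
    rw [this, ← hlognn, div_self hlogn.ne']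
  rw [← starSum_snoc_of_half_lt hadm (pvec n (p * m)) hwpos (t := 2 * (Real.log p / Real.log n)) (by linarith)]
  exact hadm.2.2.2.2 _ (by omega) _
    (entries_of_sum_eq_one (by omega) (fun l => hν.le.trans (forall_snoc_lt hwlow (by linarith) l).le)
      (forall_snoc_lt hwlow (by linarith)) hsum1) hsum1

end Summit.Parity.GeneralizedHardyLittlewood.FordMaynardSieveConst01651SieveDecomposition

end
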